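import Mathlib.Analysis.SpecialFunctions.SmoothTransition
import Mathlib.Analysis.SpecialFunctions.Sqrt
import Literature.Analysis.FunctionSpaces.SLEBessel
import Literature.Analysis.FunctionSpaces.ItoFormulaProgressive
import Literature.Probability.Process.ItoIntegralLocality
import HarnessLib

/-!
# The SLE–Bessel bridge: Itô's formula for `√Z` before `T₀`, and `sle_bessel_holds`

Topic `Analysis/FunctionSpaces`; sibling proof file of
`Literature/Analysis/FunctionSpaces/ItoProcesses.lean` and `SLEBessel.lean`. It discharges the named
fact `Literature.Analysis.FunctionSpaces.sle_bessel` (Rohde–Schramm 2005, §6, proof of Lemma 6.2: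
"Set `Y_x(t) := g_t(x) - ξ(t)`. Then `Y_x(t)/√κ` is a Bessel process of dimension `1 + 4/κ`";
`dY_x = (2/Y_x) dt + dξ`) by proving the one remaining hypothesis **S** of the reduction
`Literature.Analysis.FunctionSpaces.sle_bessel_of_sqrt_eq` (`SLEBessel.lean`):

* **S** (`IsSquaredBesselProcess.ae_sqrt_eq_neg_brownian`): if `Z` solves the squared Bessel
  equation `dZ = δ dt + 2√|Z| d(-B)`, `Z₀ = z₀`, driven by `-B` on the canonical space (raw
  Brownian filtration), then almost surely, for every `t` with `Z > 0` on `[0, t]`,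
  `√Z_t = √z₀ - B_t + ((δ - 1)/2) ∫₀ᵗ ds/√Z_s` — Itô's formula for the square root before the
  hitting time of `0` (Revuz–Yor, Ch. XI, §1, the display after Def. (1.9); Lawler, §1.10, the
  defining SDE `dX = (a/X) dt + dB` of the Bessel process up to `T_x`).

Proof of **S**. The square root is not `C²` at `0`, so Itô's formula for Itô processes
(`Literature.Analysis.FunctionSpaces.ito_formula_itoProcess_ae`, proved in `ItoFormulaProofs`) is
applied to `C²` functions `f` which agree with `√·` on `(a, ∞)`, `a > 0` (`f = √ψ` for a smooth
"soft floor" `ψ`, a monotone modification of the identity, constant `a/2` below `a/2`, built from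
`Real.smoothTransition`: `exists_contDiff_eq_sqrt_of_lt`). Writing `Z = z₀ + δ t + ∫ σ' dB` with
`σ' = -2√|Z|` (sign rules of `ItoIntegralNegation`), Itô's formula gives, a.s. for all `t`,
`f(Z_t) = f(z₀) + ∫₀ᵗ (δ f' + ½ σ'² f'')(Z_s) ds + K_t`, `K = ∫ σ' f'(Z) dB`. On the event
`E_q = {Z > a on [0, q]}` (`q` rational) the integrand `σ' f'(Z)` is the constant `-1` on
`[0, q]`, so by the **local character of the Itô integral**
(`IsItoIntegral.ae_eqOn_of_brownian`, Revuz–Yor IV Prop. (2.11)) and `∫ (-1) dB = -B`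
(`isItoIntegral_const_brownian`), a.s. on `E_q`, `K = -B` on `[0, q]`; and there the drift is
`δ/(2√Z) - (4Z)/(8 Z√Z) = ((δ-1)/2)/√Z`. Countably many levels `a = 1/(n+1)` and rationals `q`
cover every `t` with `Z > 0` on `[0, t]` (a continuous path bounded below by `min_{[0,t]} Z > a`
stays above `a` slightly beyond `t`). Progressive measurability of `σ'`, required by the Itô
formula of the tree, is obtained by passing to the left-regularised version `dyadicReg Z`
(`IsStrongSolution.dyadicReg_spec`), indistinguishable from `Z`.

Finally `sle_bessel_holds : sle_bessel` is `sle_bessel_of_sqrt_eq` fed with **S**.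

## References

* S. Rohde, O. Schramm, *Basic properties of SLE*, Ann. of Math. 161 (2005), 883–924, §2.1
  (`ξ(t) = √κ B_t`, `∂ₜ g_t = 2/(g_t - ξ(t))`) and §6, proof of Lemma 6.2.
* D. Revuz, M. Yor, *Continuous Martingales and Brownian Motion* (3rd ed., 1999), Ch. IV,
  Prop. (2.11), Thm (3.3); Ch. XI, §1, Def. (1.1), Def. (1.9) and the display after it.
* G. F. Lawler, *Conformally Invariant Processes in the Plane*, AMS (2005), §1.10, §6.2.
-/

open MeasureTheory ProbabilityTheory Filter Set
open scoped NNReal ENNReal Topology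

noncomputable section

namespace Literature.Analysis.FunctionSpaces

/-! ### Smooth modifications of the square root away from `0` -/

section Cutoff

variable {a z : ℝ} {f : ℝ → ℝ}

/-- **A `C²` modification of the square root away from `0`.** For every level `a > 0` there is a
`C²` function `f : ℝ → ℝ` with `f = √·` on `(a, ∞)`: take `f = √ψ` for the smooth *soft floor*
`ψ(z) = a/2 + (z - a/2) · smoothTransition (2z/a - 1)` (Mathlib's `Real.smoothTransition`), which
equals `z` on `[a, ∞)` and stays `≥ a/2 > 0`, so that `√ψ` is smooth. This is the localisation
device for applying Itô's formula (stated in this tree for `f ∈ C²(ℝ)`) to `√Z` before `Z`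
reaches `0` (Revuz–Yor, Ch. IV, Remark 2° after Thm (3.3); Ch. XI, §1, p. 446). [folklore] -/
theorem exists_contDiff_eq_sqrt_of_lt (ha : 0 < a) :
    ∃ f : ℝ → ℝ, ContDiff ℝ 2 f ∧ ∀ z, a < z → f z = Real.sqrt z := by
  -- the soft floor `ψ`
  have hψ_of_le : ∀ z, a ≤ z →
      a / 2 + (z - a / 2) * Real.smoothTransition (2 * z / a - 1) = z := by
    intro z hz
    have h1 : 1 ≤ 2 * z / a - 1 := by
      rw [le_sub_iff_add_le, le_div_iff₀ ha]
      linarith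
    rw [Real.smoothTransition.one_of_one_le h1, mul_one]
    ring
  have hψ_pos : ∀ z, 0 < a / 2 + (z - a / 2) * Real.smoothTransition (2 * z / a - 1) := by
    intro z
    rcases le_or_gt (a / 2) z with h | h
    · have : 0 ≤ (z - a / 2) * Real.smoothTransition (2 * z / a - 1) :=
        mul_nonneg (sub_nonneg.2 h) (Real.smoothTransition.nonneg _)
      linarith
    · have h0 : 2 * z / a - 1 ≤ 0 := by
        rw [sub_nonpos, div_le_one ha]
        linarith
      rw [Real.smoothTransition.zero_of_nonpos h0, mul_zero, add_zero]
      exact half_pos ha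
  have hψ_smooth : ContDiff ℝ 2
      fun z : ℝ ↦ a / 2 + (z - a / 2) * Real.smoothTransition (2 * z / a - 1) := by
    have h : ContDiff ℝ 2 fun z : ℝ ↦ Real.smoothTransition (2 * z / a - 1) :=
      (Real.smoothTransition.contDiff (n := 2)).comp
        (((contDiff_const.mul contDiff_id).div_const a).sub contDiff_const)
    exact contDiff_const.add ((contDiff_id.sub contDiff_const).mul h)
  refine ⟨fun z ↦ Real.sqrt (a / 2 + (z - a / 2) * Real.smoothTransition (2 * z / a - 1)),
    hψ_smooth.sqrt fun z ↦ (hψ_pos z).ne', fun z hz ↦ ?_⟩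
  simp only [hψ_of_le z hz.le]

/-- A function agreeing with `√·` on `(a, ∞)` agrees with it near every point of `(a, ∞)`.
[folklore] -/
theorem eventuallyEq_sqrt_of_eq_sqrt (hf : ∀ z, a < z → f z = Real.sqrt z) (hz : a < z) :
    f =ᶠ[𝓝 z] Real.sqrt :=
  eventually_of_mem (Ioi_mem_nhds hz) fun y hy ↦ hf y hy

/-- The derivative of a modification of `√·` on `(a, ∞)`, `a > 0`, at `z > a`: `1/(2√z)`.
[folklore] -/
theorem hasDerivAt_of_eq_sqrt (hf : ∀ z, a < z → f z = Real.sqrt z) (ha : 0 < a) (hz : a < z) :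
    HasDerivAt f (1 / (2 * Real.sqrt z)) z :=
  (Real.hasDerivAt_sqrt (ha.trans hz).ne').congr_of_eventuallyEq (eventuallyEq_sqrt_of_eq_sqrt hf hz)

/-- The derivative of a modification of `√·` on `(a, ∞)`, `a > 0`, at `z > a`: `1/(2√z)`.
[folklore] -/
theorem deriv_of_eq_sqrt (hf : ∀ z, a < z → f z = Real.sqrt z) (ha : 0 < a) (hz : a < z) :
    deriv f z = 1 / (2 * Real.sqrt z) :=
  (hasDerivAt_of_eq_sqrt hf ha hz).deriv

/-- The derivative of `z ↦ 1/(2√z)` at `z > 0` is `-1/(4 z √z)`. [folklore] -/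
theorem hasDerivAt_one_div_two_mul_sqrt (hz : 0 < z) :
    HasDerivAt (fun x : ℝ ↦ 1 / (2 * Real.sqrt x)) (-1 / (4 * z * Real.sqrt z)) z := by
  have hs : Real.sqrt z ≠ 0 := (Real.sqrt_pos.2 hz).ne'
  have hz' : z ≠ 0 := hz.ne'
  have h := (hasDerivAt_const z (1 : ℝ)).fun_div ((Real.hasDerivAt_sqrt hz').const_mul 2)
    (mul_ne_zero two_ne_zero hs)
  refine h.congr_deriv ?_
  rw [mul_pow, Real.sq_sqrt hz.le]
  field_simp
  ring

/-- The second derivative of a modification of `√·` on `(a, ∞)`, `a > 0`, at `z > a`: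
`-1/(4 z √z)`. [folklore] -/
theorem iteratedDeriv_two_of_eq_sqrt (hf : ∀ z, a < z → f z = Real.sqrt z) (ha : 0 < a)
    (hz : a < z) : iteratedDeriv 2 f z = -1 / (4 * z * Real.sqrt z) := by
  rw [iteratedDeriv_succ, iteratedDeriv_one]
  have h1 : deriv f =ᶠ[𝓝 z] fun x ↦ 1 / (2 * Real.sqrt x) :=
    eventually_of_mem (Ioi_mem_nhds hz) fun _ hy ↦ deriv_of_eq_sqrt hf ha hy
  rw [h1.deriv_eq]
  exact (hasDerivAt_one_div_two_mul_sqrt (ha.trans hz)).deriv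

/-- **The Itô drift of the square root along the squared Bessel equation.** For a modification
`f` of `√·` on `(a, ∞)`, `a > 0`, at `z > a`, with diffusion coefficient `σ' = -2√|z|` and drift
`δ`: `∂ₜ f + δ f'(z) + ½ σ'² f''(z) = δ/(2√z) - 1/(2√z) = ((δ - 1)/2) (√z)⁻¹` (no time
dependence). This is the computation behind "`ρ = √Z` solves `dρ = ((δ-1)/2) ρ⁻¹ dt + dβ`"
(Revuz–Yor, Ch. XI, §1, display after Def. (1.9), p. 446). [folklore] -/
theorem itoDrift_of_eq_sqrt (hf : ∀ z, a < z → f z = Real.sqrt z) (ha : 0 < a) (hz : a < z)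
    (δ r : ℝ) :
    deriv (fun _ : ℝ ↦ f z) r + δ * deriv f z +
        2⁻¹ * (-(2 * Real.sqrt |z|)) ^ 2 * iteratedDeriv 2 f z =
      (δ - 1) / 2 * (Real.sqrt z)⁻¹ := by
  have hz0 : 0 < z := ha.trans hz
  have hs : Real.sqrt z ≠ 0 := (Real.sqrt_pos.2 hz0).ne'
  have hz' : z ≠ 0 := hz0.ne'
  rw [deriv_const, deriv_of_eq_sqrt hf ha hz, iteratedDeriv_two_of_eq_sqrt hf ha hz,
    abs_of_pos hz0, neg_sq, mul_pow, Real.sq_sqrt hz0.le]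
  field_simp
  ring

/-- On `{z > a}` the Itô integrand `σ' f'(z) = -2√|z| · (1/(2√z))` of a modification `f` of `√·`
on `(a, ∞)`, `a > 0`, is the constant `-1`. [folklore] -/
theorem neg_two_sqrt_mul_deriv_of_eq_sqrt (hf : ∀ z, a < z → f z = Real.sqrt z) (ha : 0 < a)
    (hz : a < z) : -(2 * Real.sqrt |z|) * deriv f z = -1 := by
  have hz0 : 0 < z := ha.trans hz
  have hs : Real.sqrt z ≠ 0 := (Real.sqrt_pos.2 hz0).ne'
  rw [deriv_of_eq_sqrt hf ha hz, abs_of_pos hz0]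
  field_simp

end Cutoff

/-! ### Itô's formula for `√Z` before the hitting time of `0` -/

section SqrtIto

open Literature.Probability.Process Literature.Probability.RandomPlanarGeometry

variable {δ z₀ : ℝ} {Z : ℝ≥0 → (ℝ≥0 → ℝ) → ℝ}

/-- **Itô's formula for a modified square root along a squared Bessel process driven by `-B`,
localised** (progressive version of the solution, fixed level `a > 0`): almost surely, for every
`t` admitting a rational `q ≥ t` with `Z > a` on `[0, q]`,
`√Z_t = √Z_0 - B_t + ((δ-1)/2) ∫₀ᵗ (√Z_s)⁻¹ ds`. Ingredients: `Z = Z₀ + δt + ∫ σ' dB` with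
`σ' = -2√|Z|` (`IsItoIntegral.neg_neg_right`); Itô's formula `ito_formula_itoProcess_ae_holds` for
a `C²` modification `f` of `√·` on `(a, ∞)` (`exists_contDiff_eq_sqrt_of_lt`) with
`K = ∫ σ' f'(Z) dB` (`exists_isItoIntegral_mul_of_continuous`); the local character of the Itô
integral on `E_q = {Z > a on [0, q]}`, where `σ' f'(Z) = -1`
(`IsItoIntegral.ae_eqOn_of_brownian`, `isItoIntegral_const_brownian`); and the drift computation
`itoDrift_of_eq_sqrt`.
Revuz–Yor, *Continuous Martingales and Brownian Motion* (1999), Ch. IV, Prop. (2.11), Thm (3.3)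
and Remark 2°; Ch. XI, §1, display after Def. (1.9). [folklore] -/
theorem IsSquaredBesselProcess.ae_sqrt_eq_of_level
    (hZ : IsSquaredBesselProcess δ z₀ Z (fun t ω ↦ -brownian t ω) brownianFiltration
      preWienerMeasure)
    (hprog : IsStronglyProgressive brownianFiltration Z) {a : ℝ} (ha : 0 < a) :
    ∀ᵐ ω ∂preWienerMeasure, ∀ t : ℝ≥0,
      (∃ q : ℚ, t ≤ (q : ℝ).toNNReal ∧ ∀ s ≤ (q : ℝ).toNNReal, a < Z s ω) →
        Real.sqrt (Z t ω) = Real.sqrt (Z 0 ω) + -brownian t ω +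
          (δ - 1) / 2 * ∫ s in (0 : ℝ)..t, (Real.sqrt (Z s.toNNReal ω))⁻¹ := by
  obtain ⟨-, hZa, hint, J, hJ, heq⟩ := hZ
  -- `Z = Z₀ + δ t + ∫ σ' dB` with `σ' = -2√|Z|`, an Itô process driven by `B`
  have hJ' : IsItoIntegral (fun s ω ↦ -(2 * Real.sqrt |Z s ω|)) brownian J brownianFiltration
      preWienerMeasure := by
    simpa only [neg_neg] using hJ.neg_neg_right
  have hX : IsItoProcess Z (fun _ _ ↦ δ) (fun s ω ↦ -(2 * Real.sqrt |Z s ω|)) brownian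
      brownianFiltration preWienerMeasure :=
    ⟨hint, J, hJ', heq⟩
  have hσ' : IsStronglyProgressive brownianFiltration (fun s ω ↦ -(2 * Real.sqrt |Z s ω|)) :=
    IsStronglyProgressive.comp_measurable₂ hprog
      (F := fun (_ : ℝ) (z : ℝ) ↦ -(2 * Real.sqrt |z|))
      ((continuous_const.mul (Real.continuous_sqrt.comp
        (continuous_abs.comp continuous_snd))).neg).measurable
  -- Itô's formula for a `C²` modification `f` of `√·` on `(a, ∞)`
  obtain ⟨f, hfc, hf⟩ := exists_contDiff_eq_sqrt_of_lt ha
  have hf2 : ContDiff ℝ 2 (Function.uncurry fun (_ : ℝ) ↦ f) := hfc.comp contDiff_snd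
  have hf1 : ContDiff ℝ 1 (Function.uncurry fun (_ : ℝ) ↦ f) := hf2.of_le (by norm_num)
  obtain ⟨K, hK⟩ := exists_isItoIntegral_mul_of_continuous exists_isItoIntegral_holds hσ' hJ'
    (adapted_deriv_apply hf1 hZa) (hX.ae_continuous_deriv_apply hf1)
  have hI := ito_formula_itoProcess_ae_holds (fun (_ : ℝ) ↦ f) hf2 hZa hσ' hX hK
  -- local character of `K` on `E_q = {Z > a on [0, q]}`: there `σ' f'(Z) = -1`, so `K = -B`
  have hloc : ∀ q : ℚ, ∀ᵐ ω ∂preWienerMeasure,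
      ω ∈ {ω | ∀ s ≤ (q : ℝ).toNNReal, a < Z s ω} →
        ∀ s ≤ (q : ℝ).toNNReal, -1 * brownian s ω = K s ω := fun q ↦
    (isItoIntegral_const_brownian (-1)).ae_eqOn_of_brownian hK
      (ae_of_all _ fun _ ↦ measurable_const)
      fun ω hω s hs ↦ (neg_two_sqrt_mul_deriv_of_eq_sqrt hf ha (hω s hs)).symm
  filter_upwards [hI, ae_all_iff.2 hloc] with ω hIω hLω
  rintro t ⟨q, htq, hq⟩
  have hZgt : ∀ s ≤ t, a < Z s ω := fun s hs ↦ hq s (hs.trans htq)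
  have hKt : K t ω = -brownian t ω := by
    rw [← hLω q hq t htq, neg_one_mul]
  have h1 := hIω t
  -- the drift integral
  have hdrift : (∫ s in (0 : ℝ)..t,
      (deriv (fun r : ℝ ↦ f (Z s.toNNReal ω)) (s.toNNReal : ℝ) + δ * deriv f (Z s.toNNReal ω) +
        2⁻¹ * (-(2 * Real.sqrt |Z s.toNNReal ω|)) ^ 2 * iteratedDeriv 2 f (Z s.toNNReal ω))) =
      (δ - 1) / 2 * ∫ s in (0 : ℝ)..t, (Real.sqrt (Z s.toNNReal ω))⁻¹ := by
    rw [← intervalIntegral.integral_const_mul]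
    refine intervalIntegral.integral_congr fun s hs ↦ ?_
    rw [Set.uIcc_of_le t.coe_nonneg] at hs
    exact itoDrift_of_eq_sqrt hf ha (hZgt _ (Real.toNNReal_le_iff_le_coe.2 hs.2)) δ _
  rw [hdrift, hKt, hf _ (hZgt t le_rfl), hf _ (hZgt 0 zero_le)] at h1
  linarith

/-- **Itô's formula for `√Z` before the hitting time of `0`, progressive case**: if `Z` is a
progressively measurable solution of the squared Bessel equation `dZ = δ dt + 2√|Z| d(-B)`,
`Z₀ = z₀`, driven by `-B` (canonical space, raw Brownian filtration), then almost surely, for every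
`t` with `Z > 0` on `[0, t]`, `√Z_t = √z₀ - B_t + ((δ-1)/2) ∫₀ᵗ (√Z_s)⁻¹ ds`. From
`IsSquaredBesselProcess.ae_sqrt_eq_of_level` at the levels `1/(n+1)`: a continuous path with
`Z > 0` on `[0, t]` is bounded below there by `min_{[0,t]} Z > 1/(n+1)` for some `n`, and stays
above this level up to some rational `q > t`.
Revuz–Yor, *Continuous Martingales and Brownian Motion* (1999), Ch. XI, §1, display after
Def. (1.9) (`ρ_t = √x + β_t + ((δ-1)/2) ∫₀ᵗ ρ_s⁻¹ ds`); Lawler (2005), §1.10. [folklore] -/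
theorem IsSquaredBesselProcess.ae_sqrt_eq_of_isStronglyProgressive
    (hZ : IsSquaredBesselProcess δ z₀ Z (fun t ω ↦ -brownian t ω) brownianFiltration
      preWienerMeasure)
    (hprog : IsStronglyProgressive brownianFiltration Z) :
    ∀ᵐ ω ∂preWienerMeasure, ∀ t : ℝ≥0, (∀ s ≤ t, 0 < Z s ω) →
      Real.sqrt (Z t ω) = Real.sqrt z₀ + -brownian t ω +
        (δ - 1) / 2 * ∫ s in (0 : ℝ)..t, (Real.sqrt (Z s.toNNReal ω))⁻¹ := by
  have hlev := fun n : ℕ ↦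
    hZ.ae_sqrt_eq_of_level hprog (a := 1 / ((n : ℝ) + 1)) Nat.one_div_pos_of_nat
  have h0 : ∀ ω, Z 0 ω = z₀ := hZ.apply_zero
  filter_upwards [ae_all_iff.2 hlev, IsStrongSolution.ae_continuous hZ] with ω hω hcω t ht
  -- a level `1/(n+1)` below `min_{[0,t]} Z`
  obtain ⟨s₀, hs₀, hmin⟩ := (isCompact_Icc (a := (0 : ℝ≥0)) (b := t)).exists_isMinOn
    (Set.nonempty_Icc.2 zero_le) hcω.continuousOn
  obtain ⟨n, hn⟩ := exists_nat_one_div_lt (ht s₀ hs₀.2)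
  have hZgt : ∀ s ≤ t, 1 / ((n : ℝ) + 1) < Z s ω := fun s hs ↦
    hn.trans_le ((isMinOn_iff.1 hmin) s ⟨zero_le, hs⟩)
  -- the path stays above the level up to some rational `q > t`
  have hnhds : (fun s ↦ Z s ω) ⁻¹' Set.Ioi (1 / ((n : ℝ) + 1)) ∈ 𝓝 t :=
    hcω.continuousAt.preimage_mem_nhds (Ioi_mem_nhds (hZgt t le_rfl))
  obtain ⟨ε, hε, hball⟩ := Metric.mem_nhds_iff.1 hnhds
  obtain ⟨q, hq1, hq2⟩ := exists_rat_btwn (lt_add_of_pos_right (t : ℝ) hε)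
  have hq0 : (0 : ℝ) ≤ q := t.coe_nonneg.trans hq1.le
  have hcoe : (((q : ℝ).toNNReal : ℝ≥0) : ℝ) = q := Real.coe_toNNReal _ hq0
  have htq : t ≤ (q : ℝ).toNNReal := by
    rw [← NNReal.coe_le_coe, hcoe]
    exact hq1.le
  have hmem : ∀ s ≤ (q : ℝ).toNNReal, 1 / ((n : ℝ) + 1) < Z s ω := by
    intro s hs
    rcases le_or_gt s t with hst | hst
    · exact hZgt s hst
    · apply hball
      rw [Metric.mem_ball, NNReal.dist_eq]
      have h1 : (t : ℝ) < s := NNReal.coe_lt_coe.2 hst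
      have h2 : (s : ℝ) ≤ q := by
        rw [← hcoe]
        exact NNReal.coe_le_coe.2 hs
      rw [abs_of_pos (sub_pos.2 h1)]
      linarith
  have key := hω n t ⟨q, htq, hmem⟩
  rwa [h0 ω] at key

/-- **Itô's formula for `√Z` before the hitting time of `0`** (fact **S** of the SLE–Bessel
bridge): if `Z` solves the squared Bessel equation `dZ = δ dt + 2√|Z| d(-B)`, `Z₀ = z₀`, driven by
`-B` on the canonical space with its raw Brownian filtration, then almost surely, for every `t`
with `Z > 0` on `[0, t]`,
`√Z_t = √z₀ + (-B_t) + ((δ - 1)/2) ∫₀ᵗ (√Z_s)⁻¹ ds`,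
i.e. `ρ = √Z` solves the Bessel SDE `dρ = ((δ-1)/2) ρ⁻¹ dt + dβ` driven by `β = -B` before it
reaches `0`. Revuz–Yor print this application of Itô's formula to `BESQ^δ(x)` and `√·` for
`δ ≥ 2`, where `0` is polar ("`X_t^{1/2} = √x + β_t + ((δ-1)/2) ∫₀ᵗ X_s^{-1/2} ds` … BES^δ(a),
`a > 0`, is a solution to the SDE `ρ_t = a + β_t + ((δ-1)/2) ∫₀ᵗ ρ_s⁻¹ ds`", p. 446); the form
proved here, localised before the first zero of `Z`, needs no restriction on `δ` and is Lawler's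
defining equation of the Bessel process (§1.10, `X_t = x + B_t + a∫₀ᵗ ds/X_s`, `t < T_x`). No sign
hypothesis on `δ, z₀` is needed either (the hypothesis `Z > 0` on `[0, t]` carries everything).
Reduced to the progressive case by the left regularisation `dyadicReg Z`, which is again a
solution and is indistinguishable from `Z` (`IsStrongSolution.dyadicReg_spec`).
Revuz–Yor, *Continuous Martingales and Brownian Motion* (1999), Ch. XI, §1, Def. (1.1),
Def. (1.9) and the display after it (p. 446); Ch. IV, Thm (3.3) and Remark 2°; Lawler (2005),
§1.10. [cite: RevuzYor1999, Ch. XI §1 Def. (1.9) and the display after it (p. 446)] -/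
theorem IsSquaredBesselProcess.ae_sqrt_eq_neg_brownian
    (hZ : IsSquaredBesselProcess δ z₀ Z (fun t ω ↦ -brownian t ω) brownianFiltration
      preWienerMeasure) :
    ∀ᵐ ω ∂preWienerMeasure, ∀ t : ℝ≥0, (∀ s ≤ t, 0 < Z s ω) →
      Real.sqrt (Z t ω) = Real.sqrt z₀ + -brownian t ω +
        (δ - 1) / 2 * ∫ s in (0 : ℝ)..t, (Real.sqrt (Z s.toNNReal ω))⁻¹ := by
  obtain ⟨hZ', hprog, hae⟩ := IsStrongSolution.dyadicReg_spec hZ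
  filter_upwards [IsSquaredBesselProcess.ae_sqrt_eq_of_isStronglyProgressive hZ' hprog, hae]
    with ω hω hωeq t ht
  have h := hω t fun s hs ↦ by rw [hωeq]; exact ht s hs
  simpa only [hωeq] using h

end SqrtIto

/-! ### Discharge of `sle_bessel` -/

/-- **The SLE–Bessel bridge holds** (discharge of the named fact `sle_bessel`): for chordal SLE_κ
(`κ > 0`) with driving function `Wₜ = √κ Bₜ` and a real point `x > 0`, there is a Bessel process
`ρ` of dimension `1 + 4/κ` started at `x/√κ` and driven by `-B` (the square root of a squared Bessel
process `BESQ^{1+4/κ}(x²/κ)` on the canonical space, raw Brownian filtration) such that, almost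
surely, `ρ_t = (gₜ(x) - Wₜ)/√κ` for all `t` before the swallowing time of `x`. Assembly of the
reduction `sle_bessel_of_sqrt_eq` (`SLEBessel.lean`: existence of squared Bessel processes driven
by `-B`, and the deterministic identification of a positive solution of the flow equation
`dY = (2/Y) dt - dW` with the real Loewner flow) with Itô's formula for `√Z` before `T₀`
(`IsSquaredBesselProcess.ae_sqrt_eq_neg_brownian`).
Rohde–Schramm, *Basic properties of SLE*, Ann. of Math. 161 (2005), §6, proof of Lemma 6.2
("Set `Y_x(t) := g_t(x) - ξ(t)` … Then `Y_x(t)/√κ` is a Bessel process of dimension `1 + 4/κ`";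
"`dY_x = (2/Y_x) dt + dξ`"), with §2.1 for `ξ = √κ B` and the chordal Loewner equation;
Lawler (2005), §6.2.
[cite: RohdeSchramm2005, §6 remark after Lemma 6.2] -/
theorem sle_bessel_holds : sle_bessel :=
  sle_bessel_of_sqrt_eq fun _ _ _ _ _ hZ ↦ hZ.ae_sqrt_eq_neg_brownian

end Literature.Analysis.FunctionSpaces
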